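import Literature.AlgebraicGeometry.Frobenioids.RlfStructureWeak
import Literature.AnabelianGeometry.EtaleTheta.FrdIVocabularyWeak
import Literature.AnabelianGeometry.EtaleTheta.Discharge.Sec3Thm37SubQFT
import Literature.AnabelianGeometry.EtaleTheta.Discharge.Sec4Prop42SubRootLawModel

/-!
# [EtTh] Prop 4.2 (iii): the torsion-freeness input `hTF` of the root-law reduction (G-w4d044-3) DISCHARGED at
# the WEAK [FrdI] vocabulary `treeMonoidVocabWeak` — weak twin of `Sec4Prop42SubRootLawTreeVocab.lean`

Mochizuki, *The étale theta function …*, Publ. RIMS **45** (2009), §3 Def 3.6 (i) PDF p.76 («`Φ₀^ℝ := Φ₀^rlf`»), §4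
Prop 4.2 (iii)(iv) PDF p.88; [FrdI] Def 2.4 (i) kurims p.48 (the realification `M^rlf`)
[cite: MochizukiEtTh2009, Def 3.6 p.76].  abc-iut cell, layer L2, plan/GAP-LEDGER.md G-w4d044-3 / D-G-w4d044-3
(abc-iut-w4-d044 gen 3: `Sec4Prop42SubRootLawModel.lean` p432007, `hR ⇐ hR₀ + Φ perfect + hTF`; and
`Sec4Prop42SubRootLawTreeVocab.lean`, `hTF` a THEOREM at `V := treeMonoidVocab`).  Seat abc-iut-w6-d037 (gen 2).
PROOF-ONLY (0 `def`s); nothing of abc-iut-w4-d044's is edited or restated.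

At the WEAK canonical vocabulary `V := treeMonoidVocabWeak` (`FrdIVocabularyWeak.lean`, abc-iut-L2-t3 / L2-d2:
`IsRealification := IsRealificationViaWeak`, i.e. `Φ₀^ℝ(Y) ≃* (Φ₀(Y))^rlf` for the WEAK realification
`IsPerfFactorialWeak.Rlf` — the vocabulary of record at the tempered coverings `Ÿ`, `Z_∞` with infinitely many
special-fibre components, where [FrdI] Def 2.4 (i)(d) fails, finding F-L2d2-1) `hTF` is a THEOREM for the same
two-line reason: the weak `M^rlf` is perfect (`IsPerfFactorialWeak.Rlf.isPerfect`, abc-iut-L1's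
`RlfStructureWeak.lean`; cf. abc-iut-L2-d2's `TemperedFrobenioid.isPerfect_ΦRlog_weak`), perfectness transports along
the isomorphism and passes to the groupification (`isPerfect_grothendieckGroup`), whose `N`-th power maps are
injective.  Hence:
* `RealifiedDivisorMonoids.pow_injective_ΦR_gp_treeVocabWeak` — `hTF` at the weak vocabulary;
* `Prop42Sub.prop42_iii_iv_mkOfModelCanonical_of_baseRootLaw_treeVocabWeak` — at the canonical model over the WEAK
  vocabulary, [EtTh] Prop 4.2 (iii) ∧ (iv) ⇐ {`Φ` divisorial, `hDSpull`, `hR₀` (`B₀^Λ`-level root law, ERRATUM E2),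
  `hE`, `hS`, `hL`} — abc-iut-w4-d044's `prop42_iii_iv_mkOfModelCanonical_of_baseRootLaw` (vocabulary-generic) with
  `hTF` discharged; the statement names the vocabulary (`Prop42_iii (V := treeMonoidVocabWeak)`);
* `Prop42Sub.prop42_iii_iv_mkOfModelCanonical_of_baseRootLaw_treeCatVocabWeak` — over the canonical CATEGORY
  vocabulary `treeCatVocab` moreover "`Φ` divisorial" is the Def 3.6 (ii) field (abc-iut's
  `TemperedFrobenioid.isDivisorial_divisorMonoid`): ⇐ {`hDSpull`, `hR₀`, `hE`, `hS`, `hL`}.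
HONEST FRAMING: refereed pre-IUT material; nothing here asserts that such data exist for an actual curve; nothing here
bears on [IUTchIII] Cor. 3.12; typed ≠ proved — here PROVED.
-/

noncomputable section

namespace Literature.AnabelianGeometry.EtaleTheta

open CategoryTheory Opposite Literature.AlgebraicGeometry.Frobenioids

universe u₀ v₀ u v w

namespace RealifiedDivisorMonoids

variable {D₀ : Type u₀} [Category.{v₀} D₀]

/-- **`hTF` at the WEAK canonical vocabulary**: the `N`-th power maps (`N ≥ 1`) of `(Φ₀^ℝ(Y))^gp` are injective — the
weak realification `(Φ₀(Y))^rlf` is perfect (`IsPerfFactorialWeak.Rlf.isPerfect`), hence so are `Φ₀^ℝ(Y)` and its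
groupification (`isPerfect_grothendieckGroup`). [cite: MochizukiFrdI2008, Def. 2.4(i) p.48] -/
theorem pow_injective_ΦR_gp_treeVocabWeak (T : RealifiedDivisorMonoids (D₀ := D₀) treeMonoidVocabWeak.{w})
    (Y : D₀ᵒᵖ) {N : ℕ} (hN : 0 < N) :
    Function.Injective fun x : Algebra.GrothendieckGroup (T.ΦR.obj Y) => x ^ N :=
  have hP : IsPerfect (T.ΦR.obj Y) := by
    obtain ⟨h, e, -⟩ := (T.isRealification Y : IsRealificationViaWeak _ _ _)
    exact (IsPerfFactorialWeak.Rlf.isPerfect h).of_mulEquiv e.symm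
  ((isPerfect_grothendieckGroup hP).bijective_pow N hN).1

end RealifiedDivisorMonoids

namespace BiKummerSetting

section Canonical

variable {K : Type u₀} [Field K] (X : SemiGraphs.TemperedArithmeticGroup.{u₀} K) {D₀ : Type u₀}
  [Category.{v₀} D₀] {T : RealifiedDivisorMonoids (D₀ := D₀) treeMonoidVocabWeak.{w}}
  {D : Type u} [Category.{v} D] {VD : FrdICatStub.{u, v, w} D}
  (tf : TemperedFrobenioid T D VD) (hZ : tf.monoidType = MonoidType.Z)
  (hP : ∀ A : Dᵒᵖ, IsPerfect (tf.Φ.carrier A)) (IG : D → Prop) (gS : ∀ A : D, IG A → (X.Pi →* Aut A))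
  (gSs : ∀ (A : D) (h : IG A), Function.Surjective (gS A h))
  (NH : Subgroup (Field.absoluteGaloisGroup K) → tf.category → ℕ+ → Prop) (A₀ : tf.category)
  (hA₀ : PreFrobenioid.IsFrobeniusTrivial tf.toElem A₀) (hA₀' : IG A₀.base)

/-- **[EtTh] Prop 4.2 (iii) ∧ (iv) AS TYPED at the canonical model OVER THE WEAK [FrdI] VOCABULARY
`treeMonoidVocabWeak`, the root law for `B` (G-w4d044-3) reduced to the one for `B₀^Λ` with no further input** ⇐ {`Φ`
divisorial, `hDSpull`, `hR₀` (ERRATUM E2 at `B₀^Λ`), `hE` (G-w4d044-2), `hS` (Def 4.1 (ii)), `hL` (G-w4d044-1)}: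
abc-iut-w4-d044's `prop42_iii_iv_mkOfModelCanonical_of_baseRootLaw` (p432007) with
`hTF := T.pow_injective_ΦR_gp_treeVocabWeak`. [cite: MochizukiEtTh2009, Prop 4.2 p.88] -/
theorem Prop42Sub.prop42_iii_iv_mkOfModelCanonical_of_baseRootLaw_treeVocabWeak
    (hΦd : Objectwise (fun M _ => IsDivisorial M) tf.divisorMonoid)
    (hDSpull : ∀ {A A' : D} (e : A' ⟶ A) {a b : tf.Φ.carrier (op A)},
      (∀ x : tf.Φ.carrier (op A), x ∣ a → x ∣ b → x = 1) →
        ∀ y : tf.Φ.carrier (op A'), y ∣ pull tf.divisorMonoid e a → y ∣ pull tf.divisorMonoid e b → y = 1)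
    (hR₀ : ∀ (N : ℕ+) (A : D), IG A → ∀ b : T.BΛ.obj (op (tf.base.obj A)),
      ∃ (A' : D) (_ : IG A') (c : A' ⟶ A) (b' : T.BΛ.obj (op (tf.base.obj A'))),
        b' ^ (N : ℕ) = (T.BΛ.map (tf.base.map c).op).hom b)
    (hE : ∀ (N : ℕ+) (A' : tf.category), PreFrobenioid.IsFrobeniusTrivial tf.toElem A' → IG A'.base →
      ∃ (A'' : tf.category) (ψ : A'' ⟶ A'), PreFrobenioid.IsPullbackMorphism tf.toElem ψ ∧ IG A''.base ∧
        tf.IsMuSaturated A'' N ∧ NH (mkOfModelCanonical X tf hZ hP IG gS gSs NH A₀ hA₀ hA₀').HodotBsFld A'' N)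
    (hS : ∀ ⦃A B : D⦄ (hA : IG A) (hB : IG B) (b : B ⟶ A),
      ∃ c : X.Pi, ∀ g : X.Pi, (gS B hB g).hom ≫ b = b ≫ (gS A hA (c * g * c⁻¹)).hom)
    (hL : ∀ (A'' : tf.category) (N : ℕ+) (g : A''.base ⟶ A₀.base)
      (ξ : tf.ratFnFunctor.obj (op A₀.base)),
      PreFrobenioid.IsFrobeniusTrivial tf.toElem A'' →
      NH (mkOfModelCanonical X tf hZ hP IG gS gSs NH A₀ hA₀ hA₀').HodotBsFld A'' N →
      divB tf.divisorMonoid tf.ratFnFunctor tf.divBNatTrans (op A₀.base) ξ = 1 →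
        ∃ ζ : tf.ratFnFunctor.obj (op A''.base), ζ ^ (N : ℕ) = pull tf.ratFnFunctor g ξ) :
    Prop42_iii (V := treeMonoidVocabWeak.{w}) (mkOfModelCanonical X tf hZ hP IG gS gSs NH A₀ hA₀ hA₀')
        (fun {_ _} φ x => tf.pullFracModel φ x) ∧
      Prop42_iv (V := treeMonoidVocabWeak.{w}) (mkOfModelCanonical X tf hZ hP IG gS gSs NH A₀ hA₀ hA₀')
        (fun φ x => tf.pullFracModel φ x) :=
  Prop42Sub.prop42_iii_iv_mkOfModelCanonical_of_baseRootLaw X tf hZ hP IG gS gSs NH A₀ hA₀ hA₀' hΦd hDSpull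
    (fun A _ hN => T.pow_injective_ΦR_gp_treeVocabWeak (op (tf.base.obj A)) hN) hR₀ hE hS hL

end Canonical

/-! ### Over the canonical category vocabulary `treeCatVocab`: "`Φ` divisorial" is the Def 3.6 (ii) field -/

section CanonicalCat

variable {K : Type u₀} [Field K] (X : SemiGraphs.TemperedArithmeticGroup.{u₀} K) {D₀ : Type u₀}
  [Category.{v₀} D₀] {T : RealifiedDivisorMonoids (D₀ := D₀) treeMonoidVocabWeak.{w}}
  {D : Type u} [Category.{v} D] {IsRational IsStrictlyRational : (Dᵒᵖ ⥤ CommMonCat.{w}) → Prop}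
  (tf : TemperedFrobenioid T D (treeCatVocab D IsRational IsStrictlyRational)) (hZ : tf.monoidType = MonoidType.Z)
  (hP : ∀ A : Dᵒᵖ, IsPerfect (tf.Φ.carrier A)) (IG : D → Prop) (gS : ∀ A : D, IG A → (X.Pi →* Aut A))
  (gSs : ∀ (A : D) (h : IG A), Function.Surjective (gS A h))
  (NH : Subgroup (Field.absoluteGaloisGroup K) → tf.category → ℕ+ → Prop) (A₀ : tf.category)
  (hA₀ : PreFrobenioid.IsFrobeniusTrivial tf.toElem A₀) (hA₀' : IG A₀.base)

/-- **[EtTh] Prop 4.2 (iii) ∧ (iv) AS TYPED at the canonical model over BOTH weak canonical vocabularies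
(`treeMonoidVocabWeak`, `treeCatVocab`)** ⇐ {`hDSpull`, `hR₀`, `hE`, `hS`, `hL`} — "`Φ` divisorial" being the Def 3.6
(ii) field (abc-iut's `TemperedFrobenioid.isDivisorial_divisorMonoid`). [cite: MochizukiEtTh2009, Prop 4.2 p.88] -/
theorem Prop42Sub.prop42_iii_iv_mkOfModelCanonical_of_baseRootLaw_treeCatVocabWeak
    (hDSpull : ∀ {A A' : D} (e : A' ⟶ A) {a b : tf.Φ.carrier (op A)},
      (∀ x : tf.Φ.carrier (op A), x ∣ a → x ∣ b → x = 1) →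
        ∀ y : tf.Φ.carrier (op A'), y ∣ pull tf.divisorMonoid e a → y ∣ pull tf.divisorMonoid e b → y = 1)
    (hR₀ : ∀ (N : ℕ+) (A : D), IG A → ∀ b : T.BΛ.obj (op (tf.base.obj A)),
      ∃ (A' : D) (_ : IG A') (c : A' ⟶ A) (b' : T.BΛ.obj (op (tf.base.obj A'))),
        b' ^ (N : ℕ) = (T.BΛ.map (tf.base.map c).op).hom b)
    (hE : ∀ (N : ℕ+) (A' : tf.category), PreFrobenioid.IsFrobeniusTrivial tf.toElem A' → IG A'.base →
      ∃ (A'' : tf.category) (ψ : A'' ⟶ A'), PreFrobenioid.IsPullbackMorphism tf.toElem ψ ∧ IG A''.base ∧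
        tf.IsMuSaturated A'' N ∧ NH (mkOfModelCanonical X tf hZ hP IG gS gSs NH A₀ hA₀ hA₀').HodotBsFld A'' N)
    (hS : ∀ ⦃A B : D⦄ (hA : IG A) (hB : IG B) (b : B ⟶ A),
      ∃ c : X.Pi, ∀ g : X.Pi, (gS B hB g).hom ≫ b = b ≫ (gS A hA (c * g * c⁻¹)).hom)
    (hL : ∀ (A'' : tf.category) (N : ℕ+) (g : A''.base ⟶ A₀.base)
      (ξ : tf.ratFnFunctor.obj (op A₀.base)),
      PreFrobenioid.IsFrobeniusTrivial tf.toElem A'' →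
      NH (mkOfModelCanonical X tf hZ hP IG gS gSs NH A₀ hA₀ hA₀').HodotBsFld A'' N →
      divB tf.divisorMonoid tf.ratFnFunctor tf.divBNatTrans (op A₀.base) ξ = 1 →
        ∃ ζ : tf.ratFnFunctor.obj (op A''.base), ζ ^ (N : ℕ) = pull tf.ratFnFunctor g ξ) :
    Prop42_iii (V := treeMonoidVocabWeak.{w}) (mkOfModelCanonical X tf hZ hP IG gS gSs NH A₀ hA₀ hA₀')
        (fun {_ _} φ x => tf.pullFracModel φ x) ∧
      Prop42_iv (V := treeMonoidVocabWeak.{w}) (mkOfModelCanonical X tf hZ hP IG gS gSs NH A₀ hA₀ hA₀')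
        (fun φ x => tf.pullFracModel φ x) :=
  Prop42Sub.prop42_iii_iv_mkOfModelCanonical_of_baseRootLaw_treeVocabWeak X tf hZ hP IG gS gSs NH A₀ hA₀ hA₀'
    tf.isDivisorial_divisorMonoid hDSpull hR₀ hE hS hL

end CanonicalCat

end BiKummerSetting

end Literature.AnabelianGeometry.EtaleTheta

end
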